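import Summits.QuantumFields.YangMills.Theorems.UV3PinnedStepThroughOfMassEnvelope
import Summits.QuantumFields.YangMills.Theorems.UV3UnitDensityUpperOfPackage
import HarnessLib

/-!
# R3 (cell `ym3-torus`, YM₃ on T³ — a ladder RUNG, NOT d = 4, NOT the Clay problem) — **R-19936-U: THE ORGAN ROW `hlf` OF `stub_unitEnvelope` (TOP-LEVEL LARGE-FIELD CONTROL,
# [Balaban1985UV3] (67)–(71) + [9] §3.C AT `k = K`) IS A THEOREM MODULO hJ + hTriv — «COUNTED ONCE» WITH R-19936-S** (★★OWNER WORD 58: hJ = residual-designate of S AND U)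

Seat `ym-ust-19936-w6` g7 (R526 (S) hand; LOCATE `LOCATE-S-ORGAN-w6g7.md` §3 «§U»).  THEOREMS ONLY (0 `def`, 0 `sorry`); `--supports stmt-QuantumFields-19936 --as helper`; count-neutral;
CONDITIONAL on the v1 (α) socket `AlphaInputsT3AC.Of F 𝔠` and on the two displayed rows hJ, hTriv.

THE CHAIN BY KERNEL AFTER THIS FILE (v1 currency): `stub_unitEnvelope` (registered text) ⟸ ✓p750234 `UV3UnitDensityUpperOfPackage.stub_unitEnvelope_of_package_of_lf_ae_of_main (π)(hpkg)(hlf)(hMain)`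
⟸ **`hlf` = §2 `AlphaInputsT3AC.Of.hlf_ae_of_massEnvelope (hJ) (hTriv)`** — so R-19936-U displays, beyond the socket and `hMain`, exactly hJ (the SAME row R-19936-S displays, ✓
`UV3PinnedStepOrganOfMassEnvelope.AlphaInputsT3AC.Of.hSii_of_massEnvelope`) and hTriv.

THE ROWS.  hJ (WORD 58 letter; see the S file): `∃ A₁, ∀ K r, Admissible r → r ≠ triv → ∀ᵐ W, m_K(r, W) ≤ exp A₁`.  hTriv: `∃ A₂, ∀ K, ∀ᵐ W, m_K(triv, W) ≤ exp A₂` — the a.e. envelope of the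
TRIVIAL history's mass.  In the v1 currency (`massRecAC`) the trivial mass is FLOORED (`max 1 (T_k[…])`, `MassesAC` :47–50) and the floor compounds (`TrivMassAC`: `∫ m_k(triv) ≤ k + 1`), so
hTriv is the floor artefact, displayed SEPARATELY (WORD 58 (b)); in the v3 currency (`massRecP`, `wtP triv = 1`) it is free.  The un-pinned sum needs every history, hence both rows.

CONTENTS (at `p : AlphaInputsT3AC.PkgAt F 𝔠 γ hγ hγ1 K`): §1 ★★ `all_le_of_massEnvelope` — FILE 1 ✓`largeField_enveloped_adm` (U) instantiated exactly as the prequel's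
`through_le_of_massEnvelope` (masses `massRecAC`, small factors ✓`smallFactorsAdm_towerOfAC`, Z-terms ✓`Zterm_top_le_booked`, collar cover, progression, provisos): for a field `W` at which EVERY
admissible history has mass `≤ e^{A}`, `Σ_r m_K(r,W)·e^{−mainT_K(r,W)+Zterm_K(r)} ≤ e^{A}·e^{(6∕log L)(2L^m)³}`; §2 ★★★ `AlphaInputsT3AC.Of.hlf_ae_of_massEnvelope` — ✓p750234's a.e. `hlf` binder
(`∃ CZ, ∀ K, ∀ᵐ W, (h.dataT3 γ hγ hγ1 π).LF K K W [r ↦ −mainT + Zterm] ≤ exp CZ`; the datum's `LF` IS the finite mass sum, `rfl`) from hJ and hTriv, `CZ := max A₁ A₂ + (6∕log L)(2L^m)³`.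

HONEST SCOPE.  Bookkeeping; hJ∕hTriv DISPLAYED; nothing of `stub_unitEnvelope`, `stub_pinnedStep`, `hP′`, `HistoryTailL` (19936), the rung, d = 4, a mass gap or Clay is proved here;
no summit statement is proved by this seat.

References: T. Bałaban, Commun. Math. Phys. **102** (1985) 255–275 [Balaban1985UV3] ((5) p. 256, (41) p. 266, (67)–(71) p. 273, pp. 273–274).
-/

set_option autoImplicit false

noncomputable section

namespace Summit.QuantumFields.YangMills.Theorems.UV3UnitEnvelopeOrganOfMassEnvelope

open MeasureTheory
open scoped BigOperators
open Literature.MathematicalPhysics.QuantumFieldTheory.Balaban1983to89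
open Literature.MathematicalPhysics.QuantumFieldTheory.Balaban1983to89.B10LargeField (xlog one_le_xlog pFun_eq xlog_gRun)
open Literature.MathematicalPhysics.QuantumFieldTheory.Balaban1983to89.T3ContinuumYM3Torus
open Literature.MathematicalPhysics.QuantumFieldTheory.Balaban1983to89.T3UnitLawDensityEML (ℰp)
open Literature.MathematicalPhysics.QuantumFieldTheory.Balaban1985CMP102
open Literature.MathematicalPhysics.QuantumFieldTheory.Balaban1985CMP102.Setting
open Summit.QuantumFields.Balaban3D.Carriers
open Summit.QuantumFields.Balaban3D.Proofs.Primitives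
open Summit.QuantumFields.Balaban3D.Proofs.ScalesArithmetic (gk_pos gk_le_one g0sq_pos gk_eq_gRun_norm)
open Summit.QuantumFields.Balaban3D.Proofs.Family (prov_hb₁ prov_hb₂ prov_hp)
open Summit.QuantumFields.Balaban3D.Proofs.TowerAC
open Summit.QuantumFields.Balaban3D.Proofs.StandardAC
open Summit.QuantumFields.Balaban3D.Proofs.InputsAC
open Summit.QuantumFields.Balaban3D.Proofs.HistCount (card_filter_allCodes_le_exp)
open Summit.QuantumFields.Balaban3D.Proofs.LargeFieldStd (rcolOf_antitone rcolOf_le zcoefOf_le zcoefOf_nonneg)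
open Summit.QuantumFields.YangMills.Theorems.UV3LargeFieldEnvelopedResummation (largeField_enveloped_adm)
open Summit.QuantumFields.YangMills.Theorems.UV3TowerOfACSmallFactorsAdm (smallFactorsAdm_towerOfAC)
open Summit.QuantumFields.YangMills.Theorems.UV3PinnedStepThroughOfMassEnvelope (Zterm_top_le_booked)

variable {F : T3Family} {𝔠 : AlphaConsts F.L (suGroupModel 2).N} {γ : ℝ} {hγ : 0 < γ} {hγ1 : γ ≤ (min 𝔠.gamma0 1) ^ 2} {K : ℕ}
  (p : AlphaInputsT3AC.PkgAt F 𝔠 γ hγ hγ1 K)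

/-! ## §1 The un-pinned (41)_K sum under the envelope -/

/-- ★★ **THE UN-PINNED (41)_K HISTORY SUM UNDER A MASS ENVELOPE ON ALL ADMISSIBLE HISTORIES** — FILE 1 ✓`largeField_enveloped_adm` (U) at the v1 package (twin of the prequel's
`through_le_of_massEnvelope`, `H := univ`): `Σ_r m_K(r,W)·e^{−mainT_K(r,W) + Zterm_K(r)} ≤ e^{A}·e^{(3∕ℓ)(2L^m)³}`, `ℓ = ½ log L`. [cite: Balaban1985UV3, (41) p.266, (67)–(71) p.273, pp.273–274] -/
theorem all_le_of_massEnvelope {A : ℝ} (W : GaugeField (F.P K) K (Matrix.specialUnitaryGroup (Fin 2) ℂ))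
    (hW : ∀ r : Hist (F.P K) K,
      Hist.Admissible 𝔠.lane.carrier.M₁ (rcolOf (T3Scales F γ hγ (hγ1.trans (sq_min_one_le _ 𝔠.gamma0_pos)) K) 𝔠.lane.carrier) K r →
      (inputOfAC 𝔠.lane p.X p.𝔖).W.mass K r W ≤ Real.exp A) :
    ∑ r : Hist (F.P K) K,
        (inputOfAC 𝔠.lane p.X p.𝔖).W.mass K r W * Real.exp (-(p.T.mainT K r W) + p.T.Zterm K r)
      ≤ Real.exp A * Real.exp (3 / (Real.log F.L / 2) * (2 * (F.L : ℝ) ^ F.m) ^ 3) := by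
  classical
  set S := T3Scales F γ hγ (hγ1.trans (sq_min_one_le _ 𝔠.gamma0_pos)) K with hS
  have hSK : S.K = K := rfl
  have hL : 2 ≤ F.L := F.hL.2
  have hLr : (2 : ℝ) ≤ F.L := by exact_mod_cast hL
  have hR₁ : 0 ≤ 𝔠.lane.carrier.R₁ := 𝔠.R₁_nonneg
  have hr : 0 ≤ 𝔠.lane.carrier.r₀ := le_trans zero_le_one 𝔠.one_le_r₀
  have hM : 0 < 𝔠.lane.carrier.M₁ := 𝔠.lane.F.M₁_pos
  have hCz : 0 ≤ 𝔠.lane.carrier.Cz + 𝔠.lane.carrier.Cv := add_nonneg 𝔠.Cz_nonneg 𝔠.Cv_nonneg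
  have h5 : 0 ≤ 𝔠.lane.carrier.C₅ := 𝔠.C₅_nonneg
  have h6 : 0 ≤ 𝔠.lane.carrier.C₆ := 𝔠.C₆_nonneg
  have hc₁ : 0 ≤ 𝔠.lane.carrier.c₁ := by show (0 : ℝ) ≤ 3; norm_num
  have hNpos : 0 < (suGroupModel 2).N := (suGroupModel 2).N_pos
  have hg : ∀ i, i ≤ K → 0 < S.gk i ∧ S.gk i ≤ 1 := fun i hi => ⟨gk_pos S i, gk_le_one S S.gK_le_one i hi⟩
  have hlogL : 0 < Real.log F.L := Real.log_pos (by linarith)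
  have hℓ : 0 < Real.log (F.L : ℝ) / 2 := by positivity
  -- the site count at the unit lattice
  have hsites : (Fintype.card (Site (F.P K) K) : ℝ) = (2 * (F.L : ℝ) ^ F.m) ^ 3 := by
    rw [Site.card_site]
    have : (F.P K).sitesPerDir K = 2 * F.L ^ F.m := by simp [Params.sitesPerDir]
    rw [this]
    push_cast
    rfl
  -- the progression of the couplings
  have hx : ∀ i, i ≤ K → xlog (S.gk i) = xlog (S.gk K) + ((K - i : ℕ) : ℝ) * (Real.log F.L / 2) := by
    intro i hi
    rw [gk_eq_gRun_norm S i, gk_eq_gRun_norm S K]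
    exact xlog_gRun 1 (F.L : ℝ) S.g0sq one_pos (by linarith) (g0sq_pos S) hi
  -- the sign of `A` and the provisos
  have hA : 0 ≤ (𝔠.lane.carrier.Cz + 𝔠.lane.carrier.Cv) + 𝔠.lane.carrier.C₅ + 𝔠.lane.carrier.C₆ +
      (|𝔠.lane.carrier.logσ₀| + 𝔠.lane.carrier.dg) * 𝔠.lane.carrier.c₁ := by
    have := 𝔠.lane.carrier.dg_nonneg
    have := abs_nonneg 𝔠.lane.carrier.logσ₀
    positivity
  have hp := prov_hp 𝔠
  have hb₁ := prov_hb₁ 𝔠 hNpos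
  have hb₂ := prov_hb₂ 𝔠 hNpos
  have hcL : 𝔠.lane.consts.L = (F.L : ℝ) := rfl
  rw [hcL] at hb₁
  have hMr : (1 : ℝ) ≤ 𝔠.lane.carrier.M₁ := by exact_mod_cast hM
  have hcg : (0 : ℝ) ≤ (2 * (2 * ((𝔠.lane.carrier.R₁ + 1) * 𝔠.lane.carrier.M₁) +
      2 * ((F.L : ℝ) * (3 * ((𝔠.lane.carrier.M₁ : ℝ) - 1)) + 3 * ((F.L : ℝ) - 1)) + 20)) * 1 := by
    have h1 : (0 : ℝ) ≤ (𝔠.lane.carrier.R₁ + 1) * 𝔠.lane.carrier.M₁ := by positivity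
    have h2 : (0 : ℝ) ≤ (F.L : ℝ) * (3 * ((𝔠.lane.carrier.M₁ : ℝ) - 1)) := by nlinarith
    nlinarith
  refine (largeField_enveloped_adm (k := K) (K := K) le_rfl S.gk (b₀ := 𝔠.lane.carrier.b₀) (p₀ := 𝔠.lane.carrier.p₀)
    (A := (𝔠.lane.carrier.Cz + 𝔠.lane.carrier.Cv) + 𝔠.lane.carrier.C₅ + 𝔠.lane.carrier.C₆ +
      (|𝔠.lane.carrier.logσ₀| + 𝔠.lane.carrier.dg) * 𝔠.lane.carrier.c₁) (A₀ := 0)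
    (c₁ := 1 / (4 * ((suGroupModel 2).N : ℝ))) (gs := 1)
    (cg := 2 * (2 * ((𝔠.lane.carrier.R₁ + 1) * 𝔠.lane.carrier.M₁) + 2 * ((F.L : ℝ) * (3 * ((𝔠.lane.carrier.M₁ : ℝ) - 1)) + 3 * ((F.L : ℝ) - 1)) + 20))
    (ρ := 1) (r₀ := 𝔠.lane.carrier.r₀) (ℓ := Real.log F.L / 2) (xK := xlog (S.gk K)) (S := (2 * (F.L : ℝ) ^ F.m) ^ 3)
    (σ := 3 * Real.log F.L) (Menv := Real.exp A)
    (allCodes (F.P K) K) (fun e he => Hist.disc_lt _ e he) ?cardE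
    (Finset.univ : Finset (Hist (F.P K) K))
    (Hist.Admissible 𝔠.lane.carrier.M₁ (rcolOf S 𝔠.lane.carrier) K) Hist.disc
    (fun r _ _ => Hist.disc_subset_allCodes r) ((Hist.disc_injective K).injOn.mono (Set.subset_univ _))
    (fun r => (inputOfAC 𝔠.lane p.X p.𝔖).W.mass K r W) (fun r => p.T.mainT K r W) (fun r => p.T.Zterm K r)
    (fun i Q => ∑ e ∈ Q.filter (fun e => e.1 ≤ i),
      (2 * (2 * ((𝔠.lane.carrier.R₁ + 1) * 𝔠.lane.carrier.M₁) + 2 * ((F.L : ℝ) * (3 * ((𝔠.lane.carrier.M₁ : ℝ) - 1)) + 3 * ((F.L : ℝ) - 1)) + 20) * 1) ^ 3 *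
        xlog (S.gk e.1) ^ (3 * 𝔠.lane.carrier.r₀))
    (Real.exp_pos _).le ?madm ?menv ?sf ?zt (fun Q _ i _ => le_rfl)
    hA le_rfl (by positivity) hcg hr hℓ (by positivity) hg le_rfl hx hp ?b1 ?b2).1
  case cardE =>
    intro i hi
    have h := card_filter_allCodes_le_exp (P := F.P K) rfl hi (by show K ≤ F.m + K; omega)
    rw [hsites] at h
    exact h
  case madm =>
    intro r _ hna
    exact stdTowerInputAC_mass_eq_zero_of_not_admissible p.X 𝔠.lane.carrier p.𝔖 K r W hna
  case menv =>
    intro r _ hadm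
    rw [zero_mul, Real.exp_zero, mul_one]
    exact hW r hadm
  case sf =>
    intro r _ hadm
    exact smallFactorsAdm_towerOfAC (T3Scales_window F 𝔠 γ hγ hγ1 K) hL p.run K le_rfl W r hadm
  case zt =>
    intro r _ _
    exact Zterm_top_le_booked p r
  case b1 =>
    simpa using hb₁
  case b2 =>
    nlinarith [hb₂, hlogL]

/-! ## §2 The `hlf` row of record from hJ and hTriv -/

/-- ★★★ **THE ORGAN ROW `hlf` OF R-19936-U (✓p750234's a.e. binder, per package) FROM hJ AND hTriv.**  `CZ := max A₁ A₂ + (6∕log L)(2L^m)³`; per run the finitely many a.e. envelopes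
are gathered (`ae_all_iff`), the trivial history's from hTriv, the others from hJ; then §1; the datum's `LF_K(W)[Φ]` IS `Σ_r m_K(r,W)e^{Φ r}` (`rfl`).  With ✓p750234: `stub_unitEnvelope` ⟸ v1
socket + `hMain` + hJ + hTriv; with the S file: BOTH registered stubs of the 19936 skeleton display the ONE row hJ (+ hTriv on the U side, the v1 floor artefact).
[cite: Balaban1985UV3, (5) p.256, (41) p.266, (67)–(71) p.273, pp.273–274] -/
theorem _root_.Summit.QuantumFields.YangMills.Theorems.AlphaInputsT3AC.Of.hlf_ae_of_massEnvelope (h : AlphaInputsT3AC.Of F 𝔠)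
    (γ : ℝ) (hγ : 0 < γ) (hγ1 : γ ≤ (min 𝔠.gamma0 1) ^ 2) (π : AlphaInputsT3AC.PolymerT3 F)
    (hJ : ∃ A₁ : ℝ, ∀ (K : ℕ) (r : Hist (F.P K) K),
      Hist.Admissible 𝔠.lane.carrier.M₁ (rcolOf (T3Scales F γ hγ (hγ1.trans (sq_min_one_le _ 𝔠.gamma0_pos)) K) 𝔠.lane.carrier) K r →
      r ≠ Hist.triv (F.P K) K →
      ∀ᵐ W ∂(fieldMeasure (F.P K) K (Matrix.specialUnitaryGroup (Fin 2) ℂ)),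
        (inputOfAC 𝔠.lane (h.pkgAt γ hγ hγ1 K).X (h.pkgAt γ hγ hγ1 K).𝔖).W.mass K r W ≤ Real.exp A₁)
    (hTriv : ∃ A₂ : ℝ, ∀ (K : ℕ), ∀ᵐ W ∂(fieldMeasure (F.P K) K (Matrix.specialUnitaryGroup (Fin 2) ℂ)),
        (inputOfAC 𝔠.lane (h.pkgAt γ hγ hγ1 K).X (h.pkgAt γ hγ hγ1 K).𝔖).W.mass K (Hist.triv (F.P K) K) W ≤ Real.exp A₂) :
    ∃ CZ : ℝ, ∀ K : ℕ, ∀ᵐ W ∂fieldMeasure (F.P K) K (Matrix.specialUnitaryGroup (Fin 2) ℂ),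
      (h.dataT3 γ hγ hγ1 π).LF K K W
          (fun hh => -((h.dataT3 γ hγ hγ1 π).mainT K K hh W) + (h.dataT3 γ hγ hγ1 π).Zterm K K hh) ≤ Real.exp CZ := by
  obtain ⟨A₁, hA₁⟩ := hJ
  obtain ⟨A₂, hA₂⟩ := hTriv
  refine ⟨max A₁ A₂ + 3 / (Real.log F.L / 2) * (2 * (F.L : ℝ) ^ F.m) ^ 3, fun K => ?_⟩
  have hae : ∀ᵐ W ∂(fieldMeasure (F.P K) K (Matrix.specialUnitaryGroup (Fin 2) ℂ)), ∀ r : Hist (F.P K) K,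
      Hist.Admissible 𝔠.lane.carrier.M₁ (rcolOf (T3Scales F γ hγ (hγ1.trans (sq_min_one_le _ 𝔠.gamma0_pos)) K) 𝔠.lane.carrier) K r →
      (inputOfAC 𝔠.lane (h.pkgAt γ hγ hγ1 K).X (h.pkgAt γ hγ hγ1 K).𝔖).W.mass K r W ≤ Real.exp (max A₁ A₂) := by
    refine ae_all_iff.2 fun r => ?_
    by_cases hadm : Hist.Admissible 𝔠.lane.carrier.M₁
      (rcolOf (T3Scales F γ hγ (hγ1.trans (sq_min_one_le _ 𝔠.gamma0_pos)) K) 𝔠.lane.carrier) K r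
    · by_cases hne : r = Hist.triv (F.P K) K
      · subst hne
        filter_upwards [hA₂ K] with W hW
        exact fun _ => hW.trans (Real.exp_le_exp.mpr (le_max_right _ _))
      · filter_upwards [hA₁ K r hadm hne] with W hW
        exact fun _ => hW.trans (Real.exp_le_exp.mpr (le_max_left _ _))
    · exact Filter.Eventually.of_forall fun W h1 => absurd h1 hadm
  filter_upwards [hae] with W hW
  rw [Real.exp_add]
  exact all_le_of_massEnvelope (h.pkgAt γ hγ hγ1 K) W hW

end Summit.QuantumFields.YangMills.Theorems.UV3UnitEnvelopeOrganOfMassEnvelope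

end
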